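import Mathlib.Algebra.Category.ModuleCat.Presheaf.Generator
import Mathlib.Algebra.Category.ModuleCat.Presheaf.Colimits
import Mathlib.Algebra.Category.ModuleCat.Presheaf.Limits
import Mathlib.Algebra.Category.ModuleCat.Sheaf.Abelian
import Mathlib.Algebra.Category.ModuleCat.Sheaf.Colimits
import Mathlib.Algebra.Category.ModuleCat.Sheaf.Limits
import Mathlib.Algebra.Category.Grp.AB
import Mathlib.CategoryTheory.Abelian.GrothendieckAxioms.FunctorCategory
import Mathlib.CategoryTheory.Abelian.GrothendieckCategory.EnoughInjectives
import Mathlib.AlgebraicGeometry.Modules.Sheaf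
import HarnessLib

/-!
# Sheaves of modules form a Grothendieck abelian category; `𝒪_X`-modules have enough injectives

For a sheaf of rings `R` on a small site `(C, J)` (objects and morphisms of `C`, and the rings
`R(U)`, all in `Type u`), the abelian category `SheafOfModules.{u} R` of sheaves of `R`-modules is a
GROTHENDIECK ABELIAN category (Grothendieck, *Tôhoku* (1957), Prop. 3.1.1 with 3.1.2: "la catégorie
des faisceaux de `𝒪`-modules sur un espace topologique … satisfait à AB 5) et admet un générateur";
The Stacks Project, Tag 07A5 (3) with Tag 079H / Tag 01DU: `Mod(𝒪_X)` has enough injectives), hence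
(Grothendieck, *Tôhoku* Thm. 1.10.1, Mathlib `IsGrothendieckAbelian.enoughInjectives`) has ENOUGH
INJECTIVES. In particular the category `X.Modules` of `𝒪_X`-modules on a scheme `X` has enough
injectives (Hartshorne III.2.2 with the remark after III.2.6), which is what makes the `Ext`-groups
`Extⁱ_{𝒪_X}(E, G)` computable by injective resolutions (dimension shifting, Hartshorne III.6).

* `presheafOfModules_hasExactColimitsOfShape` — AB5 for PRESHEAVES of modules: filtered colimits are
  exact (they are computed objectwise in `Ab`, Mathlib `PresheafOfModules.toPresheaf` preserves all
  colimits and finite limits and reflects isomorphisms; `Ab`-valued functor categories are AB5).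
* `sheafOfModules_hasExactColimitsOfShape` — AB5 for SHEAVES of modules, transported along the
  sheafification adjunction (exact reflector; Mathlib `Adjunction.hasExactColimitsOfShape`).
* `freeYonedaModule R U` — the free sheaf of `R`-modules on the representable presheaf of
  sets `h_U` (the sheaf associated to Mathlib's `PresheafOfModules.free (yoneda.obj U)`; on a space:
  the extension by zero `j_!𝒪_U`), with `freeYonedaHomEquiv : (freeYoneda R U ⟶ M) ≃ M(U)` and its
  naturality; `isSeparating_freeYonedaModule`: these objects SEPARATE (Tag 01DU: the `j_!𝒪_U` generate).
* `isGrothendieckAbelian_sheafOfModules` — `IsGrothendieckAbelian.{u} (SheafOfModules.{u} R)`;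
  `isGrothendieckAbelian_modules X : IsGrothendieckAbelian.{u} X.Modules` for a scheme `X`.
  These are THEOREMS, deliberately NOT instances: an `IsGrothendieckAbelian.{u}` instance would
  trigger Mathlib's `IsGrothendieckAbelian.hasExt : HasExt.{u}`, competing with the tree's chosen
  `HasExt.{u+1} X.Modules` (`HasExt.standard`) and making the universe of every `Ext E G n` ambiguous
  (see the warning in Mathlib's `Ext/EnoughInjectives.lean`).
* `enoughInjectives_modules` — the `Prop`-valued, universe-free consequence that IS registered as an
  instance: `EnoughInjectives X.Modules` (and `enoughInjectives_sheafOfModules` for a general `R`).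

## References

* A. Grothendieck, *Sur quelques points d'algèbre homologique*, Tôhoku Math. J. 9 (1957),
  Prop. 3.1.1–3.1.2, Thm. 1.10.1. [Grothendieck1957Tohoku]
* The Stacks Project, Tags 01DU, 079H, 07A5. [StacksProject]
* R. Hartshorne, *Algebraic Geometry* (1977), III.2.2, III.2.6. [Hartshorne1977]

## Design notes

Mathlib (this pin) proves `IsGrothendieckAbelian` for `Sheaf J A` (`GrothendieckAxioms/Sheaf.lean`)
and for `ModuleCat R`, and the separating property of the free Yoneda PREsheaves of modules
(`PresheafOfModules.freeYoneda.isSeparating`), but records nothing for `SheafOfModules`; this file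
only assembles those pieces. Universe discipline: everything is stated at the single universe `u`
of the site, which is the case of `X.Modules` (`X : Scheme.{u}`, site `X.Opens`).
-/

universe u

open CategoryTheory CategoryTheory.Limits Opposite AlgebraicGeometry

namespace Literature.AlgebraicGeometry.Modules

/-! ### AB5 for presheaves and sheaves of modules -/

section Presheaves

variable {C : Type u} [Category.{u} C] (R : Cᵒᵖ ⥤ RingCat.{u})

/-- The forgetful functor from presheaves of modules to presheaves of abelian groups reflects finite
limits (it preserves them and reflects isomorphisms). [folklore] -/
noncomputable instance reflectsFiniteLimits_toPresheaf :
    ReflectsFiniteLimits (PresheafOfModules.toPresheaf.{u} R) where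
  reflects _ _ _ := reflectsLimitsOfShape_of_reflectsIsomorphisms

/-- **AB5 for presheaves of modules**: for a filtered (indeed any) small category `K` such that
`K`-indexed colimits are exact in `Ab`, `K`-indexed colimits are exact in `PresheafOfModules R` — they
are computed objectwise. [cite: Grothendieck1957Tohoku, Prop. 3.1.1] -/
theorem presheafOfModules_hasExactColimitsOfShape (K : Type u) [Category.{u} K]
    [HasExactColimitsOfShape K AddCommGrpCat.{u}] :
    HasExactColimitsOfShape K (PresheafOfModules.{u} R) :=
  HasExactColimitsOfShape.domain_of_functor K (PresheafOfModules.toPresheaf.{u} R)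

/-- Presheaves of modules satisfy AB5 (filtered colimits of size `u` are exact).
[cite: Grothendieck1957Tohoku, Prop. 3.1.1] -/
theorem presheafOfModules_ab5 : AB5OfSize.{u, u} (PresheafOfModules.{u} R) where
  ofShape K _ _ := presheafOfModules_hasExactColimitsOfShape R K

end Presheaves

section Sheaves

variable {C : Type u} [Category.{u} C] {J : GrothendieckTopology C} (R : Sheaf J RingCat.{u})
  [HasSheafify J AddCommGrpCat.{u}] [J.WEqualsLocallyBijective AddCommGrpCat.{u}]

/-- **AB5 for sheaves of modules**: exactness of `K`-indexed colimits passes from presheaves of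
modules to sheaves of modules along the sheafification adjunction, whose left adjoint is exact
(Mathlib `PresheafOfModules.sheafificationAdjunction`, `Adjunction.hasExactColimitsOfShape`).
[cite: Grothendieck1957Tohoku, Prop. 3.1.2] -/
theorem sheafOfModules_hasExactColimitsOfShape (K : Type u) [Category.{u} K]
    [HasExactColimitsOfShape K AddCommGrpCat.{u}] :
    HasExactColimitsOfShape K (SheafOfModules.{u} R) := by
  haveI := presheafOfModules_hasExactColimitsOfShape R.obj K
  exact (PresheafOfModules.sheafificationAdjunction (𝟙 R.obj)).hasExactColimitsOfShape K

/-- Sheaves of modules satisfy AB5. [cite: Grothendieck1957Tohoku, Prop. 3.1.2] -/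
theorem sheafOfModules_ab5 : AB5OfSize.{u, u} (SheafOfModules.{u} R) where
  ofShape K _ _ := sheafOfModules_hasExactColimitsOfShape R K

/-! ### The free sheaves of modules on representables separate -/

/-- **The free sheaf of `R`-modules on the representable `h_U`**: the sheaf of modules associated
to the free presheaf of modules `PresheafOfModules.free (yoneda.obj U)`; for the site of opens of a
space this is the extension by zero `j_!(𝒪_U)` of Tag 01DU / Hartshorne III.2 (proof of 2.4).
[cite: StacksProject, Tag 01DU] -/
noncomputable def freeYonedaModule (U : C) : SheafOfModules.{u} R :=
  (PresheafOfModules.sheafification (𝟙 R.obj)).obj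
    ((PresheafOfModules.free R.obj).obj (yoneda.obj U))

/-- **Universal property of the free sheaf of modules on `h_U`**: morphisms `freeYoneda R U ⟶ M`
correspond to sections of `M` over `U` (sheafification adjunction, then Mathlib's
`PresheafOfModules.freeYonedaEquiv`). [cite: StacksProject, Tag 01DU] -/
noncomputable def freeYonedaModuleHomEquiv {U : C} {M : SheafOfModules.{u} R} :
    (freeYonedaModule R U ⟶ M) ≃ M.val.obj (op U) :=
  ((PresheafOfModules.sheafificationAdjunction (𝟙 R.obj)).homEquiv _ M).trans
    (PresheafOfModules.freeYonedaEquiv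
      (M := (SheafOfModules.forget R ⋙ PresheafOfModules.restrictScalars (𝟙 R.obj)).obj M))

/-- Naturality of `freeYonedaHomEquiv` in the target: `φ ≫ f ↦ f_U (φ)`. [folklore] -/
theorem freeYonedaModuleHomEquiv_comp {U : C} {M N : SheafOfModules.{u} R}
    (φ : freeYonedaModule R U ⟶ M) (f : M ⟶ N) :
    freeYonedaModuleHomEquiv R (φ ≫ f) =
      f.val.app (op U) (freeYonedaModuleHomEquiv R φ) := by
  simp only [freeYonedaModuleHomEquiv]
  rfl

/-- **The free sheaves of modules on representables separate** (Tag 01DU: "the sheaves `j_!𝒪_U`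
form a set of generators of `Mod(𝒪_X)`"): two morphisms `M ⟶ N` of sheaves of modules that agree
after precomposition with every `freeYoneda R U ⟶ M` are equal. [cite: StacksProject, Tag 01DU] -/
theorem isSeparating_freeYonedaModule :
    ObjectProperty.IsSeparating (.ofObj (freeYonedaModule R)) := by
  intro M N f g hfg
  ext1
  ext ⟨U⟩ x
  obtain ⟨φ, rfl⟩ := (freeYonedaModuleHomEquiv R).surjective x
  rw [← freeYonedaModuleHomEquiv_comp, ← freeYonedaModuleHomEquiv_comp]
  exact congr_arg _ (hfg _ (ObjectProperty.ofObj_apply _ U) φ)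

/-- Sheaves of modules have a separator: the coproduct of the free sheaves of modules on all
representables. [cite: Grothendieck1957Tohoku, Prop. 3.1.2] -/
theorem hasSeparator_sheafOfModules : HasSeparator (SheafOfModules.{u} R) :=
  ⟨_, (isSeparating_freeYonedaModule R).isSeparator_coproduct⟩

/-- **Sheaves of modules on a small site form a Grothendieck abelian category** (AB5 + a separator;
Grothendieck, Tôhoku Prop. 3.1.2; Stacks Tag 07A5). A theorem, deliberately not an instance (see
the module docstring: it would install a second `HasExt` universe).
[cite: Grothendieck1957Tohoku, Prop. 3.1.2] -/
theorem isGrothendieckAbelian_sheafOfModules : IsGrothendieckAbelian.{u} (SheafOfModules.{u} R) :=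
  haveI := sheafOfModules_ab5 R
  haveI := hasSeparator_sheafOfModules R
  {}

/-- **Sheaves of modules have enough injectives** (Grothendieck, Tôhoku Thm. 1.10.1 applied to
Prop. 3.1.2; Stacks Tag 079H with 07A5). [cite: Grothendieck1957Tohoku, Thm. 1.10.1] -/
theorem enoughInjectives_sheafOfModules : EnoughInjectives (SheafOfModules.{u} R) :=
  haveI := isGrothendieckAbelian_sheafOfModules R
  inferInstance

end Sheaves

/-! ### `𝒪_X`-modules on a scheme -/

section Scheme

variable (X : Scheme.{u})

/-- **`Mod(𝒪_X)` is a Grothendieck abelian category** for every scheme `X` (Hartshorne III.2,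
Grothendieck Tôhoku 3.1.1–3.1.2). A theorem, not an instance (see the module docstring).
[cite: Grothendieck1957Tohoku, Prop. 3.1.2] -/
theorem isGrothendieckAbelian_modules : IsGrothendieckAbelian.{u} X.Modules :=
  isGrothendieckAbelian_sheafOfModules X.ringCatSheaf

/-- **`Mod(𝒪_X)` has enough injectives** (Hartshorne III.2.2 and the remark following III.2.6:
"every `𝒪_X`-module is a submodule of an injective `𝒪_X`-module"). Registered as an instance: it is a
universe-free `Prop`. [cite: Hartshorne1977, III.2.2] -/
instance enoughInjectives_modules : EnoughInjectives X.Modules :=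
  enoughInjectives_sheafOfModules X.ringCatSheaf

end Scheme

end Literature.AlgebraicGeometry.Modules
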